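import Summits.Langlands.Langlands.Theorems.PicardMuOrdinaryMuOrdinaryFamilyRTThorneCompanionAut
import Summits.Langlands.Langlands.Theorems.PicardMuOrdinaryMuOrdinaryFamilyRTThornePointUnramified
import HarnessLib

/-!
# Crux `MuOrdinaryFamilyRT` (stmt-Langlands-13757), line `thorne-minimal-lift`:
# glue `hasThorneCompanion_mono` — the Thorne-ready companion interface is monotone in the level (PROVED)

Glue gmono of the lead's v7 level-enlarging reduction of `stub_pointAutomorphicT`: if `S' ⊆ S''` and every place
of `S'' ∖ S'` is prime to `3`, then a Thorne-ready companion of level `S'` (`HasThorneCompanion 𝓕 F' hcpt' S' y`,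
…ThorneCompanionAut § 1) is a Thorne-ready companion of level `S''`, with the SAME witnesses `(P^c, r^c)`:

* (a) compatibility off `S'' ∪ 3` and (f) `UnramifiedOff F' S'' r^c` are weaker than their level-`S'` versions
  (`w ∉ S'' ⇒ w ∉ S'`);
* (b) polarization, (d) continuity / integrality / residual congruence, (e) ordinary shape at `w ∣ 3`, and
  (g) `Qian2022.IsAutomorphic ι r^c` do not mention the level;
* (c) potential unramifiedness at `w ∈ S''`, `w ∤ 3`: for `w ∈ S'` this is the old clause (c); for
  `w ∈ S'' ∖ S'` clause (f) at level `S'` gives GLOBAL unramifiedness `r^c.IsUnramifiedAt w`, which the local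
  criterion `isUnramifiedAt_iff_forall_absInertia` (…ThornePointUnramified § 1, the tree's discharged local–global
  compatibility `GaloisRep.isUnramifiedAt_iff_toLocal_holds`) turns into "`r^c ∘ res_{F'}^{F'_w}` kills
  `I_{F'_w}`", i.e. clause (c) with `U = ⊤`.

No named fact, no definition.
-/

set_option linter.dupNamespace false

namespace Summit.Langlands.Langlands.Cruxes.MuOrdinaryFamilyRT.ThorneMinimalLift

open scoped NumberField Polynomial Matrix Classical
open Field IsDedekindDomain Polynomial
open Literature.NumberTheory.GaloisRepresentations Literature.NumberTheory.Automorphic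
open Summit.Langlands.Langlands.Cruxes.MuOrdinaryFamilyRT.CharZeroDominance

noncomputable section

/-- **Glue gmono — `HasThorneCompanion` is monotone in the level.**  If `S' ⊆ S''` and every place of `S'' ∖ S'`
is prime to `3`, a Thorne-ready companion of `ρ_y` over `F'` of level `S'` is one of level `S''` (same witnesses
`(P^c, r^c)`; clause (c) at the new places `w ∈ S'' ∖ S'` comes from clause (f) `UnramifiedOff F' S' r^c` through
the local criterion `isUnramifiedAt_iff_forall_absInertia`, with `U = ⊤`). -/
theorem hasThorneCompanion_mono : ∀ (f : ℤ[X]) (ι : PadicAlgCl 3 ≃+* ℂ) (e : K →+* ℂ) (S₀ : Finset (HeightOneSpectrum (𝓞 K))) (ρC : FramedGaloisRep K (PadicAlgCl 3) 3) (𝓕 : OrdFamily f ι e S₀ ρC) (F' : Type) [Field F'] [NumberField F'] [Algebra K F'] [IsGalois ℚ F'] (hcpt' : isCompact_glFiniteIntegralLevel 3 F') (S' S'' : Finset (HeightOneSpectrum (𝓞 F'))) (y : 𝓕.R →+* PadicAlgCl 3), S' ⊆ S'' → (∀ w ∈ S'', w ∉ S' → ((3 : ℕ) : 𝓞 F') ∉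 w.asIdeal) → HasThorneCompanion 𝓕 F' hcpt' S' y → HasThorneCompanion 𝓕 F' hcpt' S'' y := by
  intro f ι e S₀ ρC 𝓕 F' _ _ _ _ hcpt' S' S'' y hsub _h3 h
  obtain ⟨Pc, rc, hreg, ha, hb, hc, hd₁, hd₂, hd₃, he, hf, hg⟩ := h
  refine ⟨Pc, rc, hreg, ?_, hb, ?_, hd₁, hd₂, hd₃, he, ?_, hg⟩
  · -- (a) off `S''` is weaker than off `S'`
    exact fun w hw h3 => ha w (fun hw' => hw (hsub hw')) h3
  · -- (c) on `S''`: old (c) on `S'`, and (f) + the local criterion on `S'' ∖ S'`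
    intro w hw h3
    by_cases hw' : w ∈ S'
    · exact hc w hw' h3
    · refine ⟨⊤, fun τ hτ _ => ?_⟩
      exact (isUnramifiedAt_iff_forall_absInertia rc w).1 (hf w hw' h3) τ hτ
  · -- (f) off `S''` is weaker than off `S'`
    exact fun w hw h3 => hf w (fun hw' => hw (hsub hw')) h3

end

end Summit.Langlands.Langlands.Cruxes.MuOrdinaryFamilyRT.ThorneMinimalLift
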